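import Literature.AnabelianGeometry.SemiGraphs.PSCSeparatingCoverings
import Literature.AnabelianGeometry.SemiGraphs.PSCUnrVerticialOneVertex
import HarnessLib

/-!
# [CombGC] Prop. 1.2, separating-coverings step (rows F-2826 – F-2830): instance forms at the one-vertex shape

Mochizuki, *A combinatorial version of the Grothendieck conjecture*, Tohoku Math. J. **59** (2007)
[CombGC], §1, PROOF of Proposition 1.2, author's manuscript p. 9: "if `v₁ ≠ v₂` (respectively,
`e₁ ≠ e₂`), then there exists a finite étale `Π^unr_G`- (respectively, `Π_G`-) covering `G' → G` whose
restriction to the anabelioid `G_{v₂}` (respectively, `G_{e₂}`) is trivial …, but whose restriction to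
the anabelioid `G_{v₁}` (respectively, `G_{e₁}`) is nontrivial."  Typed LEVEL-WISE over one
`PSCDatum` by abc-iut-w4-d081 as `PSCDatum.VerticialSeparatingCoverings` (row F-2826),
`EdgeLikeSeparatingCoverings` (F-2827), `UnrVerticialSeparatingCoverings` (F-2828), their conjunction
`SeparatingCoverings` (F-2829) and the origin-level schema `SeparatingCoveringsHolds Ω` (F-2830)
(`PSCSeparatingCoverings.lean`, sub-DAG row P12-L01 of the abc-iut cell).

The UNIVERSAL CLOSURES of all five are refuted in the tree (`PSCSeparatingCoveringsNegative.lean`: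
two genus-`2` vertices over the trivial group), so the rows are admissible AT INSTANCES ONLY (cell
rule R5).  This PROOF-ONLY file (no `def` / `structure` / `instance`; the frozen interface is imported,
never edited) records the instance forms the tree CAN reach today, following the pattern of
`PSCSmoothProperShape.lean` / `PSCSmoothProperOrigin.lean` (rows F-0438 … F-1937):

* §1 — at every datum with ONE vertex and `Π_v = Π` (the shape Def. 1.1 extracts from a SMOOTH
  curve, affine or proper: one irreducible component, no nodes; cusps allowed) over EVERY topological
  group, the verticial statement F-2826 and the unramified-verticial statement F-2828 HOLD
  (`verticialSeparatingCoverings_of_vertGp_eq_top`, `unrVerticialSeparatingCoverings_of_vertGp_eq_top`):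
  every finite étale covering of such a `G` has exactly one vertex over `v` (the double coset
  `V' γ Π = Π`), so — exactly as in print, where a covering of a smooth curve is again a smooth curve —
  there is never a pair of distinct vertices to separate; with no edges the edge-like statement F-2827
  holds likewise (`edgeLikeSeparatingCoverings_of_isEmpty`), hence F-2829 at the smooth-proper shape
  (`separatingCoverings_of_smoothProper`);
* §2 — F-2830 at every origin `Ω` all of whose data are of smooth-proper shape
  (`separatingCoveringsHolds_of_smoothProper`), and antitonicity of the schema in the origin
  (`separatingCoveringsHolds_anti`: a smaller origin inherits it);
* §3 — the smooth-proper origin `Ω_sp` of `PSCUnrVerticialOneVertex.exists_smoothProperOrigin_holds`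
  (INHABITED by the genuine sturdy datum of a smooth proper genus-`2` curve in characteristic `0`,
  carrier `Ŝ₂` = profinite completion of the surface group `Γ_{2,0}`, `Σ` = all primes) satisfies
  F-2830 jointly with the ten companion rows F-0438/0440/0443/0444/0458/0459/0461/0466/1931/1937
  (`exists_smoothProperOrigin_separatingCoveringsHolds`).

What this is NOT: the printed statement at multi-component pointed stable curves (the gluing of finite
étale coverings of the anabelioids `G_v`, `G_e`) — that needs the pointed-stable-curve origin of
Def. 1.1 (i), absent from the tree (abc-iut FOUNDATIONS rows 13–14); at one vertex the printed sentence
and its typing are both vacuous in the pair quantifier, which is all that is claimed.  Consistency /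
shape evidence for the typed rows, not an endorsement; FACT policy: the rows stay assumption labels at
the geometric origin; nothing here takes a side on [IUTchIII] Cor. 3.12.
[cite: MochizukiCombGC2007, Prop 1.2 proof p.9]
-/

noncomputable section

namespace Literature.AnabelianGeometry.SemiGraphs

namespace PSCDatum

open scoped Pointwise
open Literature.GroupTheory.CombinatorialGroupTheory
open Literature.IUT.HodgeTheaters (profiniteCompletion)

universe u

variable {P : Type u} [Group P] [TopologicalSpace P]

/-! ### §1 Data of one-vertex shape with `Π_v = Π` -/

section Shape

variable (G : PSCDatum P)

omit [TopologicalSpace P] in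
/-- Everything lies in the double coset `H · a · Π`: over a vertex (or edge) whose group is `Π`, a
covering has exactly one vertex (edge). [cite: MochizukiCombGC2007, Def 1.1(ii) p.6] -/
theorem mem_doubleCoset_top_right (a x : P) (H : Set P) (hH : (1 : P) ∈ H) :
    x ∈ DoubleCoset.doubleCoset a H ((⊤ : Subgroup P) : Set P) :=
  DoubleCoset.mem_doubleCoset.mpr ⟨1, hH, a⁻¹ * x, Subgroup.mem_top _, by group⟩

omit [TopologicalSpace P] in
/-- With right group `Π` all double cosets `H γ Π` coincide (they are all of `Π`).
[cite: MochizukiCombGC2007, Def 1.1(ii) p.6] -/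
theorem doubleCoset_top_right_eq (a b : P) (H : Subgroup P) :
    DoubleCoset.doubleCoset a (H : Set P) ((⊤ : Subgroup P) : Set P) =
      DoubleCoset.doubleCoset b (H : Set P) ((⊤ : Subgroup P) : Set P) := by
  ext x
  exact ⟨fun _ => mem_doubleCoset_top_right b x _ H.one_mem,
    fun _ => mem_doubleCoset_top_right a x _ H.one_mem⟩

/-- **Row F-2826 at the one-vertex shape `Π_v = Π`** (every smooth curve: one irreducible component,
no nodes, cusps allowed): `VerticialSeparatingCoverings` holds over every topological group — at every
level `V' := V` there is exactly one vertex, so no pair of distinct vertices has to be separated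
(print: a finite étale covering of a smooth curve is a smooth curve).
[cite: MochizukiCombGC2007, Prop 1.2 proof p.9] -/
theorem verticialSeparatingCoverings_of_vertGp_eq_top (hV : ∀ v, G.vertGp v = ⊤) (v₀ : G.graph.V)
    (hv : ∀ w, w = v₀) : G.VerticialSeparatingCoverings := by
  intro V hVN hVO
  refine ⟨V, hVN, hVO, le_rfl, fun v₁ v₂ γ₁ γ₂ h => ?_⟩
  exfalso
  rcases h with hne | hne
  · exact hne (by rw [hv v₁, hv v₂])
  · rw [hV v₁, hV v₂] at hne
    exact hne (doubleCoset_top_right_eq _ _ V)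

/-- **Row F-2827 with no edges** (no nodes, no cusps: the smooth-proper shape):
`EdgeLikeSeparatingCoverings` holds vacuously over every topological group.
[cite: MochizukiCombGC2007, Prop 1.2 proof p.9] -/
theorem edgeLikeSeparatingCoverings_of_isEmpty [hN : IsEmpty G.graph.N] [hC : IsEmpty G.graph.C] :
    G.EdgeLikeSeparatingCoverings := by
  intro V hVN hVO
  refine ⟨V, hVN, hVO, le_rfl, fun e₁ => ?_⟩
  rcases e₁ with e | c
  · exact hN.elim e
  · exact hC.elim c

variable [IsTopologicalGroup P]

/-- **Row F-2828 at the one-vertex shape `Π_v = Π`**: `UnrVerticialSeparatingCoverings` holds over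
every topological group (sturdy or not) — `Π_v · Ker = Π`, so at every level there is one vertex of the
`Π^unr`-covering over `v` and no pair to separate. [cite: MochizukiCombGC2007, Prop 1.2 proof p.9] -/
theorem unrVerticialSeparatingCoverings_of_vertGp_eq_top (hV : ∀ v, G.vertGp v = ⊤) (v₀ : G.graph.V)
    (hv : ∀ w, w = v₀) : G.UnrVerticialSeparatingCoverings := by
  intro _ V hVN hVO
  refine ⟨V, hVN, hVO, le_rfl, fun v₁ v₂ γ₁ γ₂ h => ?_⟩
  exfalso
  rcases h with hne | hne
  · exact hne (by rw [hv v₁, hv v₂])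
  · rw [hV v₁, hV v₂, top_sup_eq] at hne
    exact hne (doubleCoset_top_right_eq _ _ V)

/-- **Row F-2829 at the smooth-proper shape** (one vertex, no edges, `Π_v = Π`): all three cases of
the separating-coverings step hold. [cite: MochizukiCombGC2007, Prop 1.2 proof p.9] -/
theorem separatingCoverings_of_smoothProper [IsEmpty G.graph.N] [IsEmpty G.graph.C]
    (hV : ∀ v, G.vertGp v = ⊤) (v₀ : G.graph.V) (hv : ∀ w, w = v₀) : G.SeparatingCoverings :=
  ⟨G.verticialSeparatingCoverings_of_vertGp_eq_top hV v₀ hv, G.edgeLikeSeparatingCoverings_of_isEmpty,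
    G.unrVerticialSeparatingCoverings_of_vertGp_eq_top hV v₀ hv⟩

end Shape

/-! ### §2 The origin-level schema F-2830 -/

section Origin

variable (Ω : PSCOrigin.{u})

/-- **Row F-2830 at every origin whose data are of smooth-proper shape** (one vertex, no nodes, no
cusps, `Π_v = Π`). [cite: MochizukiCombGC2007, Prop 1.2 proof p.9] -/
theorem separatingCoveringsHolds_of_smoothProper
    (hΩ : ∀ ⦃Q : Type u⦄ [Group Q] [TopologicalSpace Q] (G : PSCDatum Q), Ω.IsOfPSCType G →
      IsEmpty G.graph.N ∧ IsEmpty G.graph.C ∧ (∀ v, G.vertGp v = ⊤) ∧ ∃ v₀ : G.graph.V, ∀ w, w = v₀) :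
    SeparatingCoveringsHolds Ω := by
  intro Q _ _ _ G hG
  obtain ⟨_, _, hV, v₀, hv⟩ := hΩ G hG
  exact G.separatingCoverings_of_smoothProper hV v₀ hv

/-- **F-2830 is antitone in the origin**: an origin all of whose data belong to an origin satisfying
the schema satisfies it (how instance forms at several shapes combine).
[cite: MochizukiCombGC2007, Prop 1.2 proof p.9] -/
theorem separatingCoveringsHolds_anti (Ω' : PSCOrigin.{u})
    (hle : ∀ ⦃Q : Type u⦄ [Group Q] [TopologicalSpace Q] (G : PSCDatum Q),
      Ω'.IsOfPSCType G → Ω.IsOfPSCType G)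
    (h : SeparatingCoveringsHolds Ω) : SeparatingCoveringsHolds Ω' :=
  fun _ _ _ _ G hG => h G (hle G hG)

end Origin

/-! ### §3 The inhabited smooth-proper origin satisfies F-2830 together with its ten companion rows -/

/-- **Joint satisfiability at the smooth-proper origin, now ELEVEN rows.**  The origin
`Ω_sp` := "one vertex, no nodes, no cusps, `Π_v = Π`" is inhabited by the genuine sturdy datum of a
smooth proper genus-`2` curve in characteristic `0` (carrier `Ŝ₂` = profinite completion of the
surface group `Γ_{2,0}`, `Σ` = all primes, genus `2`) and satisfies F-2830 (the separating-coverings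
step of the proof of Prop. 1.2) together with F-0438 (Prop. 1.2 (ii)), F-0459 (Prop. 1.2 (i)), F-0440
(Prop. 1.5 (i)), F-0443 (Prop. 1.5 (ii)), F-0458 (Thm. 1.6 (i)), F-0444 (Thm. 1.6 (ii)), F-0461
(Thm. 1.6 (iii)), F-0466 (Rmk. 1.4.3), F-1931 (Rmk. 1.2.3 (iv) cuspidal), F-1937 (Rmk. 1.2.3 (v))
(`PSCUnrVerticialOneVertex.exists_smoothProperOrigin_holds`).  Consistency evidence for the typed family,
not the printed theorems. [cite: MochizukiCombGC2007, §1 pp.8-14] -/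
theorem exists_smoothProperOrigin_separatingCoveringsHolds :
    ∃ Ω : PSCOrigin.{0},
      (∃ G : PSCDatum (profiniteCompletion (PuncturedSurfaceGroup 2 0)),
        Ω.IsOfPSCType G ∧ G.IsSturdy ∧ G.Sigma = {p | p.Prime} ∧ G.graph.i = 1 ∧ G.graph.n = 0 ∧
          G.graph.r = 0 ∧ ∀ v, G.vertGp v = ⊤ ∧ G.genus v = 2) ∧
      SeparatingCoveringsHolds Ω ∧
      CommensurableTerminalityHolds Ω ∧ OpenInterDeterminesComponentHolds Ω ∧
      EdgeLikeIncidenceHolds Ω ∧ GraphicIffEdgeLikeVerticialHolds Ω ∧ NumericallyCuspidalIffHolds Ω ∧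
      GraphicIffFiltrationPreservingHolds Ω ∧ UnrVerticialIffHolds Ω ∧ AuxiliaryCoveringsExistHolds Ω ∧
      CuspidalEdgeLikeCharacterizationHolds Ω ∧ NodalEdgeLikeCharacterizationHolds Ω := by
  let Ω : PSCOrigin.{0} :=
    ⟨fun G => IsEmpty G.graph.N ∧ IsEmpty G.graph.C ∧ (∀ v, G.vertGp v = ⊤) ∧
      ∃ v₀ : G.graph.V, ∀ w, w = v₀⟩
  have hΩ : ∀ ⦃Q : Type⦄ [Group Q] [TopologicalSpace Q] (G : PSCDatum Q), Ω.IsOfPSCType G →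
      IsEmpty G.graph.N ∧ IsEmpty G.graph.C ∧ (∀ v, G.vertGp v = ⊤) ∧ ∃ v₀ : G.graph.V, ∀ w, w = v₀ :=
    fun _ _ _ _ h => h
  let G : PSCDatum (profiniteCompletion (PuncturedSurfaceGroup 2 0)) :=
    { Sigma := {p | p.Prime}
      sigma_prime := fun _ hp => hp
      sigma_nonempty := ⟨2, Nat.prime_two⟩
      graph := { V := Unit, N := Empty, C := Empty, nodeEnds := Empty.elim, cuspEnd := Empty.elim }
      vertGp := fun _ => ⊤
      nodeGp := Empty.elim
      cuspGp := Empty.elim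
      genus := fun _ => 2
      isClosed_vertGp := fun _ => by rw [Subgroup.coe_top]; exact isClosed_univ
      isClosed_nodeGp := fun e => e.elim
      isClosed_cuspGp := fun c => c.elim
      nodeGp_le := fun e => e.elim
      cuspGp_le := fun c => c.elim
      proSigma := ⟨fun _ _ _ hp _ => hp⟩ }
  exact ⟨Ω, ⟨G, ⟨inferInstanceAs (IsEmpty Empty), inferInstanceAs (IsEmpty Empty), fun _ => rfl,
      (), fun _ => rfl⟩, fun _ => le_rfl, rfl, rfl, rfl, rfl, fun _ => ⟨rfl, rfl⟩⟩,
    separatingCoveringsHolds_of_smoothProper Ω hΩ,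
    commensurableTerminalityHolds_of_smoothProper Ω hΩ,
    openInterDeterminesComponentHolds_of_smoothProper Ω hΩ, edgeLikeIncidenceHolds_of_smoothProper Ω hΩ,
    graphicIffEdgeLikeVerticialHolds_of_smoothProper Ω hΩ,
    numericallyCuspidalIffHolds_of_smoothProper Ω hΩ,
    graphicIffFiltrationPreservingHolds_of_smoothProper Ω hΩ, unrVerticialIffHolds_of_smoothProper Ω hΩ,
    auxiliaryCoveringsExistHolds_of_smoothProper Ω hΩ,
    cuspidalEdgeLikeCharacterizationHolds_of_smoothProper Ω hΩ,
    nodalEdgeLikeCharacterizationHolds_of_smoothProper Ω hΩ⟩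

end PSCDatum

end Literature.AnabelianGeometry.SemiGraphs

end
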